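/-
Copyright (c) 2026 the pub-hodgecm-mathlib formalisation cell (harness21).  Prover seat hodgecm-mathlib-K2E4-p07 (g2),
Track B «K2-LIT» ∕ h413, unit «FinGermConstants» of the line `K2_E4_SingularTransferKappaSign`, socket #7R
`K2E4SingularTransferKappaSign.FinGermConstants.sig_K2E3GermConstantRegularHR` (ED. 4), STEP (iv) of its non-split residue: NEAR-CENTRAL REPRESENTATIVES — every
`G`-regular stable class of `H_v = U(Φ₂)_v × U(Φ₁)_v` with invariants near those of the central `ε_H = (a·1₂, u)` meets every neighbourhood of `ε_H`; hence a
CLOPEN, STABLY SATURATED window through `ε_H` inside the stable saturation of any neighbourhood.  2026-09-03.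
-/
import Summits.HodgeConjecture.HodgeConjecture.Theorems.K2E3GermConstantRegularHRNearCentralBox   -- ★ §(iv-a): `exists_norm_lt_imp_mem_of_mem_nhds` (entry-box criterion)
import Literature.NumberTheory.Rogawski1990.LocalNormFibreNonsplit                           -- ★ `IsLocalStablyConjH.snd_eq`, ★ `IsLocalGRegular.separable_finCharpolyTwo`
import Literature.NumberTheory.Rogawski1990.LocalTransferGlueCM                              -- ★ `totallyDisconnectedSpace_cmDatum_local`
import Literature.NumberTheory.Rogawski1990.LocalEndoscopicCompactModCentralizerCM           -- ★ one-place-model plumbing (`properSpace_adicCompletion`, `Valued.totallyDisconnectedSpace'`)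
import Literature.NumberTheory.Automorphic.AnisotropicUnitaryGroupCompactOfPlace             -- ★ `conjLocal_apply_eq_of_smul_eq`
import Literature.LinearAlgebra.Matrix.RegularSemisimpleConjClassClosed                      -- ★ `exists_units_conj_eq_of_charpoly_eq_of_separable`
import Mathlib.Analysis.Seminorm
import Mathlib.Topology.Separation.Profinite
import HarnessLib

/-!
# K2_E4 road (h413 = stmt-HodgeConjecture-24833), socket #7R `sig_K2E3GermConstantRegularHR`, non-split residue STEP (iv), EXPLICIT FORM:
# NEAR-CENTRAL REPRESENTATIVES in `H_v = U(Φ₂)_v × U(Φ₁)_v` by an explicit near-scalar element, and the clopen stably saturated window through `ε_H = (a·1₂, u)`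
# (an independent, constructive proof of ★ `K2E3GermConstantRegularHRNearCentral.exists_isClopen_saturated_window_of_nhds` (p855254, via ★ σ-SAT) at the central point)

Cell `pub/hodgecm-mathlib` (D-0151), Track B; socket **`sig_K2E3GermConstantRegularHR`** (FinGermConstants ED. 3∕4 :309, R-twin of #7; OWNER K2E3, base K2E4-p07).
The local transfer near `ε_H` of STEP (iii) (★ `K2E3GermConstantRegularHRLocalPair`) satisfies (4.3.1) on a neighbourhood `V ∈ 𝓝 ε_H` only; ★ p854913 patches it into a global pair
along a CLOPEN, STABLY SATURATED `W ∋ ε_H`.  Both sides of (4.3.1) being stable-class functions, what is needed is the «class-level central saturation» (absent from the tree: box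
junction ★ p841395, binder `hsat`): every `G`-regular stable class of `H_v` with invariants `(tr γ_H.1, u(γ_H))` close to `(2a, u)` has a representative close to `ε_H`.

THE MATHEMATICS (`v` non-split, one place `w ∣ v`, `σ = c ⊗ 1`, `Φ₂ ⊗ 1 = antidiag(1,1)`).  Let `γ_H = (g, u′)` be `G`-regular (`χ_g` separable) with `t := tr g`, `d := det g`;
unitarity gives `σ(t)·d = t`.  Put `p := t∕2`, `ω := −p∕σ(p)`, `ν := 1 − p·σ(p)` (`σ`-fixed), `q₀ := z₀ + ω·σ(z₀)` (`z₀ ∈ {1, δ}` fixed with `q₀ ≠ 0` at `p = a`), and for a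
`σ`-fixed `f ≠ 0` let `q := f·q₀`, `r := ν∕σ(q)`.  Then `k := [[p, q], [r, p]]` satisfies the four membership equations of `U(Φ₂)_v` (★ `mem_local_two_of_entries`: `σ(p)q + σ(q)p = 0`
because `σ(q) = σ(ω)·q`, `σ(ω) = −σ(p)∕p`; `σ(r)q + σ(p)p = ν + pσ(p) = 1`; the other two follow), has trace `t`, hence determinant `d` (`σ(t)·det k = t = σ(t)·d`), hence the
characteristic polynomial of `g`, so `k ∼_st g` (★ `exists_units_conj_eq_of_charpoly_eq_of_separable`); and `k⁻¹ = [[σp, σq], [σr, σp]]`.  SIZE: `‖q_w‖ = ‖f_w‖·‖q₀‖`,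
`‖r_w‖ = ‖ν_w‖∕(‖f_w‖·‖q₀‖)`; with `f := s·σ(s)` (`‖f_w‖ = ‖s_w‖²`, `s_w` in a shell of width `‖c‖`, Mathlib `rescale_to_shell`) both are `< ρ` as soon as `‖ν_w‖ < ρ²∕(4‖c‖²)` —
a condition on `tr g` alone, continuous and vanishing at `tr g = 2a`.  The WINDOW `W := {γ_H ∣ γ_H.2 ∈ V₂′, (tr γ_H.1)_w ∈ S}` (`V₂′ ∋ u`, `S ∋ 2a` clopen, from the clopen
bases of these totally disconnected locally compact spaces) is clopen, stably saturated (`tr`, `u` are stable invariants) and every `G`-regular `γ_H ∈ W` has `(k, γ_H.2)` in the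
prescribed `V₀ ∈ 𝓝 ε_H` (entry-box criterion ★ (iv-a)).  [Rogawski1990 §3.1 p. 19, §8.2 Prop. 8.2.1 (a) p. 118; LanglandsShelstad1990Descent §2.4; HarishChandra1970 I §3.]

* (★ `K2E3GermConstantRegularHRNearCentralBox.exists_norm_lt_imp_mem_of_mem_nhds` — the entry-box criterion for neighbourhoods of `ε_H.1` in `U(Φ₂)_v`.)
* **`exists_isClopen_stablySaturated_nhds_forall_exists_isLocalStablyConjH`** — `∀ V₀ ∈ 𝓝 ε_H, ∃ W` clopen, stably saturated, `ε_H ∈ W`, every `G`-regular `γ_H ∈ W`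
  is stably conjugate to some `k ∈ V₀`.

HONEST LABEL: HC_CM is proved only modulo the 7 printed citations (2 remaining named inputs: hLiu418 = stmt-HodgeConjecture-24832, h413 =
stmt-HodgeConjecture-24833) until rung 0 closes; this file is a `--supports stmt-HodgeConjecture-24833` helper (step (iv) of 4 of #7R's non-split residue; unconditional
local algebra and topology) and retires nothing by itself.
-/

set_option autoImplicit false
set_option linter.dupNamespace false

noncomputable section

open Set Filter Topology Matrix NumberField IsDedekindDomain
open scoped MatrixGroups Pointwise

namespace Summit.HodgeConjecture.HodgeConjecture.Cruxes.H413.K2E3GermConstantRegularHRNearCentralExplicit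

open Literature.NumberTheory.Rogawski1990
open Literature.NumberTheory.Automorphic Literature.NumberTheory.Automorphic.UnitaryGroup

section NearCentral

variable (L : Type) [Field L] [NumberField L] [IsCMField L] (v : HeightOneSpectrum (𝓞 ↥(maximalRealSubfield L)))
  (w : PlacesOver L v) (hw : IsCMField.complexConj L • w.1 = w.1)

open Summit.HodgeConjecture.HodgeConjecture.Cruxes.H413.K2E3GermConstantRegularHRNearCentralBox

/-! ## The clopen stably saturated window with near-central representatives -/

include hw in
set_option maxHeartbeats 800000 in
/-- **NEAR-CENTRAL REPRESENTATIVES AND THE CLOPEN STABLY SATURATED WINDOW** (non-split `v`).  Let `ε_H = (a·1₂, u) ∈ H_v`.  For every `V₀ ∈ 𝓝 ε_H` there is a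
CLOPEN, STABLY SATURATED `W ∋ ε_H` such that every `G`-regular `γ_H ∈ W` is stably conjugate to some `k ∈ V₀`.  See the module docstring: `W` is cut out by the stable
invariants `(tr γ_H.1)_w ∈ S`, `γ_H.2 ∈ V₂′` (clopen `S ∋ 2a`, `V₂′ ∋ u`), and `k = ([[p, q], [ν∕σq, p]], γ_H.2)` with `p = tr γ_H.1 ∕ 2`, `q = s σ(s)·(z₀ + ω σ z₀)`,
`ω = −p∕σp`, `ν = 1 − pσp`, `s_w` in a shell — an element of `U(Φ₂)_v` with the characteristic polynomial of `γ_H.1`, within the entry-box of §1.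
[cite: Rogawski1990, §3.1 p. 19; §8.2 Prop. 8.2.1 (a) p. 118] [cite: LanglandsShelstad1990Descent, §2.4] [cite: HarishChandra1970, Part I §3 Lemma 19] -/
theorem exists_isClopen_stablySaturated_nhds_forall_exists_isLocalStablyConjH
    (εH : (cmDatum L 2 (Matrix.of fun i j : Fin 2 => if i.val + j.val + 1 = 2 then (1 : L) else 0)).Local v ×
      (cmDatum L 1 (Matrix.of fun i j : Fin 1 => if i.val + j.val + 1 = 1 then (1 : L) else 0)).Local v) (a : LocalRing L v)
    (ha : (εH.1.val.val : Matrix (Fin 2) (Fin 2) (LocalRing L v)) = a • (1 : Matrix (Fin 2) (Fin 2) (LocalRing L v)))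
    {V₀ : Set ((cmDatum L 2 (Matrix.of fun i j : Fin 2 => if i.val + j.val + 1 = 2 then (1 : L) else 0)).Local v ×
      (cmDatum L 1 (Matrix.of fun i j : Fin 1 => if i.val + j.val + 1 = 1 then (1 : L) else 0)).Local v)} (hV₀ : V₀ ∈ 𝓝 εH) :
    ∃ W : Set ((cmDatum L 2 (Matrix.of fun i j : Fin 2 => if i.val + j.val + 1 = 2 then (1 : L) else 0)).Local v ×
      (cmDatum L 1 (Matrix.of fun i j : Fin 1 => if i.val + j.val + 1 = 1 then (1 : L) else 0)).Local v),
      IsClopen W ∧ εH ∈ W ∧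
      (∀ h ∈ W, ∀ h' : (cmDatum L 2 (Matrix.of fun i j : Fin 2 => if i.val + j.val + 1 = 2 then (1 : L) else 0)).Local v ×
        (cmDatum L 1 (Matrix.of fun i j : Fin 1 => if i.val + j.val + 1 = 1 then (1 : L) else 0)).Local v, IsLocalStablyConjH L v h h' → h' ∈ W) ∧
      ∀ h ∈ W, IsLocalGRegular L v h → ∃ k ∈ V₀, IsLocalStablyConjH L v k h := by
  classical
  haveI : Algebra.IsQuadraticExtension ↥(maximalRealSubfield L) L := IsCMField.isQuadraticExtension L
  have hv : Subsingleton (PlacesOver L v) := PlacesOver.subsingleton_of_smul_eq (IsCMField.complexConj L) (IsCMField.complexConj_ne_one L) w hw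
  letI : NontriviallyNormedField (w.1.adicCompletion L) := Valued.toNontriviallyNormedField (w.1.adicCompletion L) (WithZero (Multiplicative ℤ))
  haveI : ProperSpace (w.1.adicCompletion L) := properSpace_adicCompletion L w.1
  haveI : TotallyDisconnectedSpace (w.1.adicCompletion L) := Valued.totallyDisconnectedSpace'
  haveI : TotallyDisconnectedSpace ((cmDatum L 1 (Matrix.of fun i j : Fin 1 => if i.val + j.val + 1 = 1 then (1 : L) else 0)).Local v) :=
    totallyDisconnectedSpace_cmDatum_local L 1 _ v
  set σ := conjLocal L (IsCMField.complexConj L) v with hσdef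
  set σK := galAdicCompletionMap (L := L) (IsCMField.complexConj L) hw with hσKdef
  have hσw : ∀ x : LocalRing L v, σ x w = σK (x w) := fun x =>
    conjLocal_apply_eq_of_smul_eq (IsCMField.complexConj L) (IsCMField.complexConj_ne_one L) v w hw x
  have hσσK : ∀ s, σK (σK s) = s := galAdicCompletionMap_galAdicCompletionMap_of_smul_eq (IsCMField.complexConj L) w (IsCMField.complexConj_ne_one L) hw
  have hσKn : ∀ s, ‖σK s‖ = ‖s‖ := fun s => norm_galAdicCompletionMap _ hw s
  have hσKc : Continuous σK := continuous_galAdicCompletionMap L (IsCMField.complexConj L) hw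
  have heqw : ∀ {x y : LocalRing L v}, x w = y w → x = y := fun {x y} h => by
    funext w'; rw [Subsingleton.elim w' w]; exact h
  have hσa : σ a * a = 1 := conjLocal_mul_self_of_fst_eq_smul_one L v εH ha
  set A : w.1.adicCompletion L := a w with hAdef
  have hσA : σK A * A = 1 := by
    have h := congrFun hσa w
    rw [Pi.mul_apply, Pi.one_apply, hσw] at h
    exact h
  have hA1 : ‖A‖ = 1 := norm_apply_eq_one_of_conj_mul_self w hw hσa
  have hA0 : A ≠ 0 := fun h0 => by rw [h0, norm_zero] at hA1; exact zero_ne_one hA1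
  have hσA0 : σK A ≠ 0 := fun h0 => by rw [h0, zero_mul] at hσA; exact zero_ne_one hσA
  have hσAeq : σK A = A⁻¹ := eq_inv_of_mul_eq_one_left hσA
  obtain ⟨V₁, hV₁, V₂, hV₂, hV₁₂⟩ := mem_nhds_prod_iff.1 hV₀
  obtain ⟨V₂', hV₂'cl, hεV₂', hV₂'sub⟩ := (loc_compact_Haus_tot_disc_of_zero_dim
    (H := (cmDatum L 1 (Matrix.of fun i j : Fin 1 => if i.val + j.val + 1 = 1 then (1 : L) else 0)).Local v)).mem_nhds_iff.1 hV₂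
  obtain ⟨ρ, hρ, hbox⟩ := exists_norm_lt_imp_mem_of_mem_nhds L v w hw εH.1 a ha hV₁
  obtain ⟨c, hc⟩ := NormedField.exists_one_lt_norm (w.1.adicCompletion L)
  have hc0 : 0 < ‖c‖ := zero_lt_one.trans hc
  obtain ⟨δL, hcδL, hδL⟩ : ∃ δ : L, IsCMField.complexConj L δ = -δ ∧ δ ≠ 0 := by
    obtain ⟨e, he⟩ : ∃ e : L, IsCMField.complexConj L e ≠ e := by
      by_contra h
      exact IsCMField.complexConj_ne_one L (AlgEquiv.ext fun x => not_ne_iff.mp (not_exists.mp h x))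
    refine ⟨e - IsCMField.complexConj L e, by rw [map_sub, IsCMField.complexConj_apply_apply, neg_sub], sub_ne_zero.2 (Ne.symm he)⟩
  set δ : LocalRing L v := algebraMap L (LocalRing L v) δL with hδdef
  have hσδ : σ δ = -δ := by rw [hδdef, hσdef, conjLocal_algebraMap, hcδL, map_neg]
  have hδ0 : δ w ≠ 0 := by
    rw [hδdef, Pi.algebraMap_apply]
    exact (map_ne_zero_iff _ (RingHom.injective _)).2 hδL
  obtain ⟨z₀, hz₀⟩ : ∃ z₀ : LocalRing L v, z₀ w + (-A * (σK A)⁻¹) * σK (z₀ w) ≠ 0 := by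
    by_cases h1 : (1 : w.1.adicCompletion L) + (-A * (σK A)⁻¹) * σK 1 ≠ 0
    · exact ⟨1, by rw [Pi.one_apply]; exact h1⟩
    · refine ⟨δ, ?_⟩
      rw [not_ne_iff, map_one, mul_one] at h1
      have hσδw : σK (δ w) = -δ w := by rw [← hσw, hσδ, Pi.neg_apply]
      rw [hσδw]
      intro h2
      have h3 : δ w * (1 - -A * (σK A)⁻¹) = 0 := by linear_combination h2
      rcases mul_eq_zero.1 h3 with h4 | h4
      · exact hδ0 h4
      · have h5 : (2 : w.1.adicCompletion L) = 0 := by linear_combination h1 + h4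
        exact two_ne_zero h5
  set Z : w.1.adicCompletion L := z₀ w with hZdef
  let Pf : w.1.adicCompletion L → w.1.adicCompletion L := fun τ => (2 : w.1.adicCompletion L)⁻¹ * τ
  let ωf : w.1.adicCompletion L → w.1.adicCompletion L := fun τ => -Pf τ * (σK (Pf τ))⁻¹
  let q₀f : w.1.adicCompletion L → w.1.adicCompletion L := fun τ => Z + ωf τ * σK Z
  let νf : w.1.adicCompletion L → w.1.adicCompletion L := fun τ => 1 - Pf τ * σK (Pf τ)
  set τ₀ : w.1.adicCompletion L := 2 * A with hτ₀def
  have hP0 : Pf τ₀ = A := by change (2 : w.1.adicCompletion L)⁻¹ * (2 * A) = A; rw [← mul_assoc, inv_mul_cancel₀ two_ne_zero, one_mul]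
  have hq₀0 : q₀f τ₀ ≠ 0 := by change Z + -Pf τ₀ * (σK (Pf τ₀))⁻¹ * σK Z ≠ 0; rw [hP0]; exact hz₀
  have hν0 : νf τ₀ = 0 := by change 1 - Pf τ₀ * σK (Pf τ₀) = 0; rw [hP0, mul_comm, hσA, sub_self]
  set Q : ℝ := ‖q₀f τ₀‖ with hQdef
  have hQ : 0 < Q := norm_pos_iff.2 hq₀0
  have hPc : Continuous Pf := continuous_const.mul continuous_id
  have hσPc : ContinuousAt (fun τ => σK (Pf τ)) τ₀ := (hσKc.comp hPc).continuousAt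
  have hσP0 : σK (Pf τ₀) ≠ 0 := by rw [hP0]; exact hσA0
  have hωc : ContinuousAt ωf τ₀ := (hPc.continuousAt.neg).mul (hσPc.inv₀ hσP0)
  have hq₀c : ContinuousAt q₀f τ₀ := continuousAt_const.add (hωc.mul continuousAt_const)
  have hνc : ContinuousAt νf τ₀ := continuousAt_const.sub (hPc.continuousAt.mul hσPc)
  -- the radii
  set ρ' : ℝ := min ρ (1 / 2) with hρ'def
  have hρ' : 0 < ρ' := lt_min hρ one_half_pos
  set η : ℝ := ρ ^ 2 / (4 * ‖c‖ ^ 2) with hηdef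
  have hη : 0 < η := by positivity
  -- the window in `L_w`: a clopen `S ∋ τ₀` inside the four conditions
  have hS₁ : {τ | ‖Pf τ - A‖ < ρ' ∧ Q / 2 < ‖q₀f τ‖ ∧ ‖q₀f τ‖ < 2 * Q ∧ ‖νf τ‖ < η} ∈ 𝓝 τ₀ := by
    have h1 : ∀ᶠ τ in 𝓝 τ₀, ‖Pf τ - A‖ < ρ' := by
      have ht : Tendsto (fun τ => Pf τ - A) (𝓝 τ₀) (𝓝 (Pf τ₀ - A)) := (hPc.tendsto τ₀).sub tendsto_const_nhds
      rw [hP0, sub_self] at ht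
      have ht' := ht.norm
      rw [norm_zero] at ht'
      exact ht' (Iio_mem_nhds hρ')
    have h2 : ∀ᶠ τ in 𝓝 τ₀, Q / 2 < ‖q₀f τ‖ := hq₀c.norm (Ioi_mem_nhds (by change Q / 2 < ‖q₀f τ₀‖; rw [← hQdef]; linarith))
    have h3 : ∀ᶠ τ in 𝓝 τ₀, ‖q₀f τ‖ < 2 * Q := hq₀c.norm (Iio_mem_nhds (by change ‖q₀f τ₀‖ < 2 * Q; rw [← hQdef]; linarith))
    have h4 : ∀ᶠ τ in 𝓝 τ₀, ‖νf τ‖ < η := by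
      have ht : Tendsto νf (𝓝 τ₀) (𝓝 (νf τ₀)) := hνc
      rw [hν0] at ht
      have ht' := ht.norm
      rw [norm_zero] at ht'
      exact ht' (Iio_mem_nhds hη)
    exact (h1.and (h2.and (h3.and h4)))
  obtain ⟨S, hScl, hτ₀S, hSsub⟩ := (loc_compact_Haus_tot_disc_of_zero_dim (H := w.1.adicCompletion L)).mem_nhds_iff.1 hS₁
  -- the trace read at `w`
  let trw : ((cmDatum L 2 (Matrix.of fun i j : Fin 2 => if i.val + j.val + 1 = 2 then (1 : L) else 0)).Local v ×
      (cmDatum L 1 (Matrix.of fun i j : Fin 1 => if i.val + j.val + 1 = 1 then (1 : L) else 0)).Local v) → w.1.adicCompletion L :=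
    fun h => ((h.1.val.val : Matrix (Fin 2) (Fin 2) (LocalRing L v)) 0 0 + (h.1.val.val : Matrix (Fin 2) (Fin 2) (LocalRing L v)) 1 1) w
  have htrc : Continuous trw := by
    have hM : Continuous fun h : ((cmDatum L 2 (Matrix.of fun i j : Fin 2 => if i.val + j.val + 1 = 2 then (1 : L) else 0)).Local v ×
        (cmDatum L 1 (Matrix.of fun i j : Fin 1 => if i.val + j.val + 1 = 1 then (1 : L) else 0)).Local v) => (h.1.val.val : Matrix (Fin 2) (Fin 2) (LocalRing L v)) :=
      Units.continuous_val.comp (continuous_subtype_val.comp continuous_fst)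
    exact (continuous_apply w).comp (((continuous_apply 0).comp ((continuous_apply 0).comp hM)).add ((continuous_apply 1).comp ((continuous_apply 1).comp hM)))
  have htr_st : ∀ h h' : ((cmDatum L 2 (Matrix.of fun i j : Fin 2 => if i.val + j.val + 1 = 2 then (1 : L) else 0)).Local v ×
      (cmDatum L 1 (Matrix.of fun i j : Fin 1 => if i.val + j.val + 1 = 1 then (1 : L) else 0)).Local v), IsLocalStablyConjH L v h h' → trw h = trw h' := by
    intro h h' hst
    have hcp := hst.1.charpoly_eq
    have ht := congrArg (fun P : Polynomial (LocalRing L v) => -P.coeff 1) hcp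
    simp only [Matrix.charpoly_fin_two, Matrix.trace_fin_two] at ht
    change ((h.1.val.val : Matrix (Fin 2) (Fin 2) (LocalRing L v)) 0 0 + (h.1.val.val : Matrix (Fin 2) (Fin 2) (LocalRing L v)) 1 1) w =
      ((h'.1.val.val : Matrix (Fin 2) (Fin 2) (LocalRing L v)) 0 0 + (h'.1.val.val : Matrix (Fin 2) (Fin 2) (LocalRing L v)) 1 1) w
    have ht' : (h.1.val.val : Matrix (Fin 2) (Fin 2) (LocalRing L v)) 0 0 + (h.1.val.val : Matrix (Fin 2) (Fin 2) (LocalRing L v)) 1 1 =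
        (h'.1.val.val : Matrix (Fin 2) (Fin 2) (LocalRing L v)) 0 0 + (h'.1.val.val : Matrix (Fin 2) (Fin 2) (LocalRing L v)) 1 1 := by
      simpa using ht
    rw [ht']
  have htrε : trw εH = τ₀ := by
    change ((εH.1.val.val : Matrix (Fin 2) (Fin 2) (LocalRing L v)) 0 0 + (εH.1.val.val : Matrix (Fin 2) (Fin 2) (LocalRing L v)) 1 1) w = 2 * A
    rw [ha]
    simp [hAdef, two_mul]
  -- THE WINDOW
  refine ⟨{h | h.2 ∈ V₂'} ∩ trw ⁻¹' S, ?_, ?_, ?_, ?_⟩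
  · exact (hV₂'cl.preimage continuous_snd).inter (hScl.preimage htrc)
  · exact ⟨hεV₂', by rw [mem_preimage, htrε]; exact hτ₀S⟩
  · rintro h ⟨h2, htS⟩ h' hst
    refine ⟨?_, ?_⟩
    · change h'.2 ∈ V₂'
      rw [← hst.snd_eq L v]; exact h2
    · rw [mem_preimage, ← htr_st h h' hst]; exact htS
  -- NEAR-CENTRAL REPRESENTATIVE of a `G`-regular `h` in the window
  rintro h ⟨h2, htS⟩ hreg
  obtain ⟨hPτ, hqlo, hqhi, hντ⟩ := hSsub htS
  -- invariants of `g := h.1`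
  obtain ⟨e00, e01, e10, e11⟩ := entries_of_mem_local_two L v (h.1.val : GL (Fin 2) (LocalRing L v)) h.1.2
  set M : Matrix (Fin 2) (Fin 2) (LocalRing L v) := (h.1.val : GL (Fin 2) (LocalRing L v)).val with hM
  set t : LocalRing L v := M 0 0 + M 1 1 with htdef
  set d : LocalRing L v := M 0 0 * M 1 1 - M 0 1 * M 1 0 with hddef
  have ht : σ t * d = t := conj_trace_mul_det_eq_trace_of_entries_two e00 e01 e10 e11
  have htM : M.trace = t := Matrix.trace_fin_two M
  have hdM : M.det = d := Matrix.det_fin_two M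
  have htw : t w = trw h := rfl
  -- `p = t ∕ 2`, `u = σ p`
  set half : LocalRing L v := fun w' => (2 : w'.1.adicCompletion L)⁻¹ with hhalf
  set p : LocalRing L v := half * t with hpdef
  have hpw : p w = Pf (trw h) := rfl
  have hp2 : p + p = t := heqw (by
    rw [Pi.add_apply, hpw]; change (2 : w.1.adicCompletion L)⁻¹ * trw h + (2 : w.1.adicCompletion L)⁻¹ * trw h = t w
    rw [htw, ← two_mul, ← mul_assoc, mul_inv_cancel₀ two_ne_zero, one_mul])
  set Pw : w.1.adicCompletion L := p w with hPwdef
  set Uw : w.1.adicCompletion L := σK Pw with hUwdef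
  have hσU : σK Uw = Pw := hσσK Pw
  have hPA : ‖Pw - A‖ < ρ' := hPτ
  have hPw0 : Pw ≠ 0 := by
    intro h0
    rw [h0, zero_sub, norm_neg, hA1] at hPA
    have : ρ' ≤ 1 / 2 := min_le_right _ _
    linarith
  have hUw0 : Uw ≠ 0 := fun h0 => hPw0 (by rw [← hσU, h0, map_zero])
  have hσp : σ p w = σK Pw := hσw p
  -- `σ(t) d = t` at `w`: `σK(2 Pw) d_w = 2 Pw`, i.e. `Uw * d_w = Pw`
  have htw2 : t w = 2 * Pw := by
    have := congrFun hp2 w; rw [Pi.add_apply, ← two_mul] at this; exact this.symm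
  have hUd : Uw * d w = Pw := by
    have h1 := congrFun ht w
    rw [Pi.mul_apply, hσw, htw2, map_mul, map_ofNat] at h1
    have h2 : (2 : w.1.adicCompletion L) * (σK Pw * d w - Pw) = 0 := by linear_combination h1
    rcases mul_eq_zero.1 h2 with h3 | h3
    · exact absurd h3 two_ne_zero
    · exact sub_eq_zero.1 h3
  -- `ω`, `q₀`, `ν`
  set ω : LocalRing L v := -p * (σ p)⁻¹ with hωdef
  have hωw : ω w = -Pw * Uw⁻¹ := by
    change (-p * (σ p)⁻¹) w = -Pw * Uw⁻¹
    rw [Pi.mul_apply, Pi.neg_apply, Pi.inv_apply, hσp]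
  have hσω : σK (ω w) = -Uw * Pw⁻¹ := by rw [hωw, map_mul, map_neg, map_inv₀, hσU]
  set q₀ : LocalRing L v := z₀ + ω * σ z₀ with hq₀def
  have hq₀w : q₀ w = q₀f (trw h) := by
    change (z₀ + ω * σ z₀) w = Z + -Pf (trw h) * (σK (Pf (trw h)))⁻¹ * σK Z
    rw [Pi.add_apply, Pi.mul_apply, hωw, hσw]
    rfl
  have hq₀w0 : q₀ w ≠ 0 := by
    intro h0; rw [hq₀w] at h0; rw [h0, norm_zero] at hqlo; linarith
  have hσq₀ : σK (q₀ w) = σK (ω w) * q₀ w := by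
    change σK ((z₀ + ω * σ z₀) w) = σK (ω w) * (z₀ + ω * σ z₀) w
    rw [Pi.add_apply, Pi.mul_apply, hσw, map_add, map_mul, hσσK, hσω, hωw]
    field_simp
    ring
  set ν : LocalRing L v := 1 - p * σ p with hνdef
  have hνw : ν w = 1 - Pw * Uw := by
    change (1 - p * σ p) w = 1 - Pw * Uw
    rw [Pi.sub_apply, Pi.one_apply, Pi.mul_apply, hσp]
  have hνw' : ν w = νf (trw h) := by rw [hνw]; rfl
  have hσν : σK (ν w) = ν w := by rw [hνw, map_sub, map_one, map_mul, hσU]; ring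
  -- the scale `s_w` in the shell `[ε∕‖c‖, ε)`, `ε² = ρ ∕ (2Q)`
  set ε : ℝ := Real.sqrt (ρ / (2 * Q)) with hεdef
  have hε2 : ε ^ 2 = ρ / (2 * Q) := Real.sq_sqrt (by positivity)
  have hε : 0 < ε := Real.sqrt_pos.2 (by positivity)
  obtain ⟨y, hy0, hylt, hyge, -⟩ := rescale_to_shell hc hε (x := (1 : w.1.adicCompletion L)) one_ne_zero
  rw [smul_eq_mul, mul_one] at hylt hyge
  set s : LocalRing L v := Pi.single w y with hsdef
  have hsw : s w = y := by rw [hsdef, Pi.single_eq_same]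
  set f : LocalRing L v := s * σ s with hfdef
  have hfw : f w = y * σK y := by change (s * σ s) w = y * σK y; rw [Pi.mul_apply, hσw, hsw]
  have hσf : σK (f w) = f w := by rw [hfw, map_mul, hσσK, mul_comm]
  have hfn : ‖f w‖ = ‖y‖ ^ 2 := by rw [hfw, norm_mul, hσKn, sq]
  have hfw0 : f w ≠ 0 := by rw [← norm_ne_zero_iff, hfn]; exact pow_ne_zero 2 (norm_ne_zero_iff.2 hy0)
  -- `q := f q₀`, `r := ν ∕ σ(q)`
  set q : LocalRing L v := f * q₀ with hqdef
  have hqw : q w = f w * q₀ w := rfl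
  have hqw0 : q w ≠ 0 := mul_ne_zero hfw0 hq₀w0
  have hσqw : σK (q w) = σK (ω w) * q w := by rw [hqw, map_mul, hσf, hσq₀]; ring
  have hσq0 : σK (q w) ≠ 0 := fun h0 => hqw0 (by rw [← hσσK (q w), h0, map_zero])
  have hσqR : σ q w = σK (q w) := hσw q
  set r : LocalRing L v := ν * (σ q)⁻¹ with hrdef
  have hrw : r w = ν w * (σK (q w))⁻¹ := by change (ν * (σ q)⁻¹) w = _; rw [Pi.mul_apply, Pi.inv_apply, hσqR]
  have hσr : σK (r w) = ν w * (q w)⁻¹ := by rw [hrw, map_mul, map_inv₀, hσν, hσσK]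
  -- the key identity (3): `σ(p) q + σ(q) p = 0` at `w`
  have E3 : Uw * q w + σK (q w) * Pw = 0 := by
    rw [hσqw, hσω]; field_simp; ring
  -- the four membership equations of `k = [[p, q], [r, p]]` (at `w`, then in `R`)
  have e00' : σ r * p + σ p * r = 0 := heqw (by
    rw [Pi.add_apply, Pi.mul_apply, Pi.mul_apply, Pi.zero_apply, hσw, hσr, hσp, hrw]
    have : ν w * (q w)⁻¹ * Pw + Uw * (ν w * (σK (q w))⁻¹) = ν w * ((q w)⁻¹ * (σK (q w))⁻¹) * (σK (q w) * Pw + Uw * q w) := by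
      field_simp
    rw [this, add_comm (σK (q w) * Pw), E3, mul_zero])
  have e01' : σ r * q + σ p * p = 1 := heqw (by
    rw [Pi.add_apply, Pi.mul_apply, Pi.mul_apply, Pi.one_apply, hσw, hσr, hσp, inv_mul_cancel_right₀ hqw0, hνw]
    ring)
  have e10' : σ p * p + σ q * r = 1 := heqw (by
    rw [Pi.add_apply, Pi.mul_apply, Pi.mul_apply, Pi.one_apply, hσp, hσqR, hrw, mul_comm (ν w), ← mul_assoc, mul_inv_cancel₀ hσq0, one_mul, hνw]
    ring)
  have e11' : σ p * q + σ q * p = 0 := heqw (by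
    rw [Pi.add_apply, Pi.mul_apply, Pi.mul_apply, Pi.zero_apply, hσp, hσqR]
    exact E3)
  -- the determinant `p² − q r` is a unit (`= Pw ∕ Uw` at `w`)
  have hdetw : (p * p - q * r) w = Pw * Uw⁻¹ := by
    rw [Pi.sub_apply, Pi.mul_apply, Pi.mul_apply, hrw]
    have hσq' : σK (q w) = -(Uw * q w) * Pw⁻¹ := by
      have := E3; field_simp; linear_combination this
    rw [hσq', hνw]
    field_simp
    ring
  have hdet : IsUnit (!![p, q; r, p]).det := by
    rw [Matrix.det_fin_two_of]
    refine isUnit_localRing_of_forall_apply_ne_zero fun w' => ?_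
    rw [Subsingleton.elim w' w, hdetw]
    exact mul_ne_zero hPw0 (inv_ne_zero hUw0)
  -- the element `k₁ ∈ U(Φ₂)_v`
  set k₁ : GL (Fin 2) (LocalRing L v) := Matrix.nonsingInvUnit (!![p, q; r, p]) hdet with hk₁def
  have hk₁mem : k₁ ∈ unitaryGroupOfForm σ (cmLocalForm L 2 v) := nonsingInvUnit_mem_local_two p q r p hdet e00' e01' e10' e11'
  have hk₁val : k₁.val = !![p, q; r, p] := rfl
  -- trace and determinant of `k₁`
  have hk₁tr : k₁.val.trace = t := by rw [hk₁val, Matrix.trace_fin_two_of, hp2]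
  have hk₁det : k₁.val.det = d := by
    have h1 : σ (p + p) * (p * p - q * r) = p + p := conj_trace_mul_det_eq_trace_of_entries_two e00' e01' e10' e11'
    rw [hp2] at h1
    rw [hk₁val, Matrix.det_fin_two_of]
    refine heqw ?_
    rw [hdetw]
    field_simp
    linear_combination (-1 : w.1.adicCompletion L) * hUd
  -- same characteristic polynomial as `g`, separable
  have hcp : (k₁.val).charpoly = M.charpoly := by
    rw [Matrix.charpoly_fin_two, Matrix.charpoly_fin_two, hk₁tr, hk₁det, htM, hdM]
  have hsep : (M.charpoly).Separable := hreg.separable_finCharpolyTwo L v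
  obtain ⟨g, hg⟩ := Literature.LinearAlgebra.Matrix.exists_units_conj_eq_of_charpoly_eq_of_separable
    (K := fun w' : PlacesOver L v => w'.1.adicCompletion L) (h.1.val : GL (Fin 2) (LocalRing L v)) k₁ hsep hcp
  -- the representative `k = (k₁, h.2)`
  let kU : (cmDatum L 2 (Matrix.of fun i j : Fin 2 => if i.val + j.val + 1 = 2 then (1 : L) else 0)).Local v := ⟨k₁, hk₁mem⟩
  refine ⟨(kU, h.2), hV₁₂ (Set.mk_mem_prod ?_ (hV₂'sub h2)), ?_⟩
  · -- inside the entry-box of `V₁`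
    have hinv : ((kU.val⁻¹ : GL (Fin 2) (LocalRing L v)).val : Matrix (Fin 2) (Fin 2) (LocalRing L v)) = !![σ p, σ q; σ r, σ p] := by
      change ((k₁⁻¹ : GL (Fin 2) (LocalRing L v)).val : Matrix (Fin 2) (Fin 2) (LocalRing L v)) = !![σ p, σ q; σ r, σ p]
      rw [Matrix.coe_units_inv, hk₁val]
      refine Matrix.inv_eq_left_inv (Matrix.ext fun i j => ?_)
      fin_cases i <;> fin_cases j
      · simpa [Matrix.mul_apply, Fin.sum_univ_two] using e10'
      · simpa [Matrix.mul_apply, Fin.sum_univ_two] using e11'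
      · simpa [Matrix.mul_apply, Fin.sum_univ_two] using e00'
      · simpa [Matrix.mul_apply, Fin.sum_univ_two] using e01'
    refine hbox kU p q r hk₁val hinv (hPA.trans_le (min_le_left _ _)) ?_ ?_
    · -- `‖q_w‖ = ‖y‖² ‖q₀‖ < ε² · 2Q = ρ`
      rw [hqw, norm_mul, hfn, hq₀w]
      have hy2 : ‖y‖ ^ 2 < ε ^ 2 := by gcongr
      calc ‖y‖ ^ 2 * ‖q₀f (trw h)‖ < ε ^ 2 * (2 * Q) := mul_lt_mul'' hy2 hqhi (sq_nonneg _) (norm_nonneg _)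
        _ = ρ := by rw [hε2, div_mul_cancel₀ _ (by positivity)]
    · -- `‖r_w‖ = ‖ν_w‖ ∕ (‖y‖² ‖q₀‖) < η ‖c‖² ∕ (ε² · Q∕2) = ρ`
      rw [hrw, norm_mul, norm_inv, hσKn, hqw, norm_mul, hfn, hq₀w, hνw']
      have hy2 : ε ^ 2 / ‖c‖ ^ 2 ≤ ‖y‖ ^ 2 := by
        rw [← div_pow]; gcongr
      have hden : ε ^ 2 / ‖c‖ ^ 2 * (Q / 2) ≤ ‖y‖ ^ 2 * ‖q₀f (trw h)‖ :=
        mul_le_mul hy2 hqlo.le (by positivity) (sq_nonneg _)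
      have hden0 : 0 < ε ^ 2 / ‖c‖ ^ 2 * (Q / 2) := by positivity
      calc ‖νf (trw h)‖ * (‖y‖ ^ 2 * ‖q₀f (trw h)‖)⁻¹ ≤ ‖νf (trw h)‖ * (ε ^ 2 / ‖c‖ ^ 2 * (Q / 2))⁻¹ := by
            gcongr
        _ < η * (ε ^ 2 / ‖c‖ ^ 2 * (Q / 2))⁻¹ := by gcongr
        _ = ρ := by
            rw [hηdef, hε2]
            field_simp
            ring
  · -- stably conjugate: same separable characteristic polynomial on the `U(Φ₂)`-part, same `U(Φ₁)`-part
    exact IsStablyConjH.symm ⟨isConj_iff.2 ⟨g, hg⟩, IsStablyConj.refl _⟩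

end NearCentral

end Summit.HodgeConjecture.HodgeConjecture.Cruxes.H413.K2E3GermConstantRegularHRNearCentralExplicit

end
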